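import Summits.AtomisticToContinuum.Crystallization.Theorems.FrustratedLawDichotomyStrainedPatchHomValueT2SoundL
import Summits.AtomisticToContinuum.Crystallization.Theorems.FrustratedLawDichotomyStrainedPatchHomValueT2SoundA2

/-!
# (I1) part M — the classed coefficients and the per-label HESSIAN of the second-edition kit enclose the real ones: ★ `mem_coefL` (`α ∈ co.al`, `β ∈ co.be`
# off the junction radii, via `…SoundA2.mem_coeffT`) and ★ `mem_hessOf` (`(hessOf R maskX)_{kl} ∋ α ζ_k ζ_l + β ν_kl`, symmetric storage, mask honoured)
# (27623 `(H) HomFloor`, hcp half; decomp-a2c hand-1 g41; I1-ROADMAP-g41 §4 (iii) / §5).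

No definitions; 0 sorry; standard axioms; no instances / notation / `#eval`.  `--supports stmt-AtomisticToContinuum-27623`.
-/

noncomputable section

namespace Summit.AtomisticToContinuum.Crystallization.Theorems.FrustratedLawDichotomyStrainedPatchHomValueT2Kit

open scoped BigOperators RealInnerProductSpace
open Finset
open Literature.Analysis.ValidatedNumerics.Numerics
open Summit.AtomisticToContinuum.Crystallization.Theorems.ChargedEnergyGapNegative (E3)
open Summit.AtomisticToContinuum.Crystallization.Theorems.FrustratedLawDichotomySchurCut (effPot w₄₅ ω₄)
open Summit.AtomisticToContinuum.Crystallization.Theorems.FrustratedLawDichotomyStrainedPatchTaylorLeaves (junctions)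

/-! ## §1. The classed coefficients -/

/-- ★ **`coefL` encloses `(α, β)`**: for `ρ > 0` off the junction radii with `ρ² ∈ Q` and `coefL Q = some co`, the true `α(ρ) ∈ co.al` and `β(ρ) ∈ co.be`
(every branch of `coefL` copies the pair of `coeffT`). [folklore chaining] -/
theorem mem_coefL {ρ : ℝ} (h0 : 0 < ρ) (hJ : ρ ∉ junctions) {Q : FI} (hq : FI.mem (ρ ^ 2) Q) {co : CoefL} (h : coefL Q = some co) :
    FI.mem ((deriv (deriv (effPot w₄₅ ω₄ (3 / 400))) ρ - deriv (effPot w₄₅ ω₄ (3 / 400)) ρ / ρ) / ρ ^ 2) co.al ∧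
      FI.mem (deriv (effPot w₄₅ ω₄ (3 / 400)) ρ / ρ) co.be := by
  unfold coefL at h
  split at h
  · cases h
  · rename_i ab hT
    have hab := mem_coeffT h0 hJ hq hT
    split_ifs at h <;> (try split at h) <;> cases h <;> exact hab

/-! ## §2. The per-label Hessian table -/

/-- Reading `hessOf` at an unmasked upper-triangle entry. [formal bookkeeping] -/
theorem hessOf_read (R : DRec) (maskX : Bool) {k l : ℕ} (hk : k < 9) (hl : l < 9) (hkl : k ≤ l) (hm : maskX = true → k < 6 ∧ l < 6) :
    (hessOf R maskX).getD (9 * k + l) fi0 = (R.co.al.mul ((R.z k).mul (R.z l))).add (R.co.be.mul (R.n k l)) := by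
  unfold hessOf
  simp only
  rw [getD_ofFn_lt _ _ (by omega : 9 * k + l < 81)]
  have e1 : (9 * k + l) / 9 = k := by omega
  have e2 : (9 * k + l) % 9 = l := by omega
  simp only [e1, e2, sIx, if_pos hkl]
  rw [getD_ofFn_lt _ _ (by omega : 9 * k + l < 81)]
  simp only [e1, e2]
  have hcond : ¬ (l < k ∨ (maskX = true ∧ (6 ≤ k ∨ 6 ≤ l))) := by
    rintro (h | ⟨hm', h⟩)
    · omega
    · have := hm hm'; omega
  rw [if_neg hcond]

/-- Reading `hessOf` at an unmasked lower-triangle entry returns the mirrored entry. [formal bookkeeping] -/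
theorem hessOf_read_swap (R : DRec) (maskX : Bool) {k l : ℕ} (hk : k < 9) (hl : l < 9) (hlk : l < k) (hm : maskX = true → k < 6 ∧ l < 6) :
    (hessOf R maskX).getD (9 * k + l) fi0 = (R.co.al.mul ((R.z l).mul (R.z k))).add (R.co.be.mul (R.n l k)) := by
  unfold hessOf
  simp only
  rw [getD_ofFn_lt _ _ (by omega : 9 * k + l < 81)]
  have e1 : (9 * k + l) / 9 = k := by omega
  have e2 : (9 * k + l) % 9 = l := by omega
  simp only [e1, e2, sIx, if_neg (not_le.2 hlk)]
  rw [getD_ofFn_lt _ _ (by omega : 9 * l + k < 81)]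
  have e3 : (9 * l + k) / 9 = l := by omega
  have e4 : (9 * l + k) % 9 = k := by omega
  simp only [e3, e4]
  have hcond : ¬ (k < l ∨ (maskX = true ∧ (6 ≤ l ∨ 6 ≤ k))) := by
    rintro (h | ⟨hm', h⟩)
    · omega
    · have := hm hm'; omega
  rw [if_neg hcond]

/-- ★★ **THE PER-LABEL HESSIAN TABLE ENCLOSES `α ζ_k ζ_l + β ν_kl`** at every unmasked entry `k, l < top` (given the record memberships of `…SoundL.mem_mkDRec`
and coefficient memberships, e.g. from `mem_coefL`). [folklore chaining] -/
theorem mem_hessOf {R : DRec} {maskX : Bool} {top : ℕ} (htop : top ≤ 9) (hm : maskX = true → top ≤ 6) {α β : ℝ} (hα : FI.mem α R.co.al)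
    (hβ : FI.mem β R.co.be) {ζ : ℕ → ℝ} {ν : ℕ → ℕ → ℝ} (hζ : ∀ k, k < top → FI.mem (ζ k) (R.z k))
    (hν : ∀ k l, k < top → l < top → FI.mem (ν k l) (R.n k l)) (hνs : ∀ k l, ν k l = ν l k) {k l : ℕ} (hk : k < top) (hl : l < top) :
    FI.mem (α * (ζ k * ζ l) + β * ν k l) ((hessOf R maskX).getD (9 * k + l) fi0) := by
  have hm' : maskX = true → k < 6 ∧ l < 6 := fun h => by have := hm h; omega
  by_cases hkl : k ≤ l
  · rw [hessOf_read R maskX (by omega) (by omega) hkl hm']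
    exact FI.mem_add (FI.mem_mul hα (FI.mem_mul (hζ k hk) (hζ l hl))) (FI.mem_mul hβ (hν k l hk hl))
  · rw [hessOf_read_swap R maskX (by omega) (by omega) (not_le.1 hkl) hm', show ζ k * ζ l = ζ l * ζ k by ring, hνs k l]
    exact FI.mem_add (FI.mem_mul hα (FI.mem_mul (hζ l hl) (hζ k hk))) (FI.mem_mul hβ (hν l k hl hk))

end Summit.AtomisticToContinuum.Crystallization.Theorems.FrustratedLawDichotomyStrainedPatchHomValueT2Kit
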